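import Summits.KontsevichZagierPeriods.KontsevichZagierPeriods.Theorems.RootDecompZetaThreeFrontierWordOrdersThreeP1

/-! # `RootDecompZetaThreeFrontierWordOrdersThreeP2` — part 2/3 of the mechanical ≤330-line split of `OrdersThree.stripped.lean`
(split by the decomp-kz census seat for landing; mathematics unchanged; part 2 continues part 1). -/

noncomputable section
set_option linter.dupNamespace false
open Set MeasureTheory MvPolynomial
open Literature.NumberTheory.Transcendental
open Literature.ModelTheory.ExponentialFields (IsSemialgebraic)

namespace Summit.KontsevichZagierPeriods.KontsevichZagierPeriods.Theorems.RootDecompZetaThreeFrontierWordMoves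

section OrdersThree

/-- Membership in `support_lift3`, unfolded. [bookkeeping] -/
theorem mem_support_lift3 {f : (Fin 3 →₀ ℕ) → (Fin 3 →₀ ℕ)} (hf : Function.Injective f) (P : MvPolynomial (Fin 3) ℚ)
    {e : Fin 3 →₀ ℕ} (he : e ∈ P.support) : f e ∈ (lift3 f P).support := by
  classical
  rw [MvPolynomial.mem_support_iff, lift3, MvPolynomial.coeff_sum,
    Finset.sum_eq_single e (fun e' _ hne => ?_) (fun hne => absurd he hne)]
  · rw [MvPolynomial.coeff_monomial, if_pos rfl]
    exact MvPolynomial.mem_support_iff.1 he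
  · rw [MvPolynomial.coeff_monomial, if_neg (fun h => hne (hf h))]

/-- the vertex lift of exponents: `t^e · (Jacobian y₂²y₀)` in the chart `Ψ₃` is `y₀^{e₁+e₂+1} y₁^{e₂} y₂^{|e|+2}` -/
def vExp (e : Fin 3 →₀ ℕ) : Fin 3 →₀ ℕ :=
  Finsupp.single 0 (e 1 + e 2 + 1) + Finsupp.single 1 (e 2) + Finsupp.single 2 (e 0 + e 1 + e 2 + 2)

/-- Auxiliary step `vExp_apply`. [bookkeeping] -/
theorem vExp_apply (e : Fin 3 →₀ ℕ) : vExp e 0 = e 1 + e 2 + 1 ∧ vExp e 1 = e 2 ∧ vExp e 2 = e 0 + e 1 + e 2 + 2 := by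
  simp [vExp]

/-- Auxiliary step `vExp_injective`. [bookkeeping] -/
theorem vExp_injective : Function.Injective vExp := by
  intro e e' h
  obtain ⟨a0, a1, a2⟩ := vExp_apply e
  obtain ⟨b0, b1, b2⟩ := vExp_apply e'
  have h0 := DFunLike.congr_fun h 0
  have h1 := DFunLike.congr_fun h 1
  have h2 := DFunLike.congr_fun h 2
  rw [a0, b0] at h0
  rw [a1, b1] at h1
  rw [a2, b2] at h2
  have k1 : e 1 = e' 1 := by omega
  have k0 : e 0 = e' 0 := by omega
  ext j
  fin_cases j
  · exact k0
  · exact k1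
  · exact h1

/-- the edge lift of exponents: `t^e · (Jacobian y₀²y₂)` in the chart `Ψ₃'` is `y₀^{|e|+2} y₁^{e₂} y₂^{e₁+e₂+1}` -/
def eExp (e : Fin 3 →₀ ℕ) : Fin 3 →₀ ℕ :=
  Finsupp.single 0 (e 0 + e 1 + e 2 + 2) + Finsupp.single 1 (e 2) + Finsupp.single 2 (e 1 + e 2 + 1)

/-- Auxiliary step `eExp_apply`. [bookkeeping] -/
theorem eExp_apply (e : Fin 3 →₀ ℕ) : eExp e 0 = e 0 + e 1 + e 2 + 2 ∧ eExp e 1 = e 2 ∧ eExp e 2 = e 1 + e 2 + 1 := by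
  simp [eExp]

/-- Auxiliary step `eExp_injective`. [bookkeeping] -/
theorem eExp_injective : Function.Injective eExp := by
  intro e e' h
  obtain ⟨a0, a1, a2⟩ := eExp_apply e
  obtain ⟨b0, b1, b2⟩ := eExp_apply e'
  have h0 := DFunLike.congr_fun h 0
  have h1 := DFunLike.congr_fun h 1
  have h2 := DFunLike.congr_fun h 2
  rw [a0, b0] at h0
  rw [a1, b1] at h1
  rw [a2, b2] at h2
  have k1 : e 1 = e' 1 := by omega
  have k0 : e 0 = e' 0 := by omega
  ext j
  fin_cases j
  · exact k0
  · exact k1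
  · exact h1

/-! ### 23c  The vertex order and the edge order forced by integrability -/

/-- **VERTEX ORDER.**  If `Q(t)/(t₀^{m₀} t₁^{m₁} (t₀-t₂)^{m₂} · D(t))` is integrable on `Δ₃`, `D ≠ 0` on `Δ₃` and, in the vertex chart,
continuous and non-zero at the face `s = 0` along every section, then every monomial of `Q` has degree `≥ m₀+m₁+m₂-2`. -/
theorem vertex_order (Q : MvPolynomial (Fin 3) ℚ) (m₀ m₁ m₂ : ℕ) (D : (Fin 3 → ℝ) → ℝ)
    (hDnz : ∀ t ∈ KZ.openOrderedSimplex 3, D t ≠ 0)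
    (hDc : ∀ x ∈ Sq, ContinuousAt (fun s : ℝ => D (vΨ (Fin.snoc x s))) 0)
    (hD0 : ∀ x ∈ Sq, D (vΨ (Fin.snoc x (0:ℝ))) ≠ 0)
    (hint : IntegrableOn (fun t => MvPolynomial.aeval t Q / (t 0 ^ m₀ * t 1 ^ m₁ * (t 0 - t 2) ^ m₂ * D t))
      (KZ.openOrderedSimplex 3)) :
    ∀ e ∈ Q.support, m₀ + m₁ + m₂ ≤ e 0 + e 1 + e 2 + 2 := by
  have h1 := integrableOn_vchart hint
  have h2 : IntegrableOn (fun y => MvPolynomial.aeval y (lift3 vExp Q) /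
      (y 2 ^ (m₀ + m₁ + m₂) * (fun y : Fin 3 → ℝ => y 0 ^ m₁ * (1 - y 0 * y 1) ^ m₂ * D (vΨ y)) y)) Cube3 := by
    refine h1.congr_fun (fun y hy => ?_) measurableSet_Cube3
    have hD : D (vΨ y) ≠ 0 := hDnz _ (vΨ_mem hy)
    obtain ⟨hy0, hy01, hy1, hy11, hy2, hy21⟩ := hy
    show y 2 ^ 2 * y 0 * (MvPolynomial.aeval (vΨ y) Q / (vΨ y 0 ^ m₀ * vΨ y 1 ^ m₁ * (vΨ y 0 - vΨ y 2) ^ m₂ * D (vΨ y))) =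
      MvPolynomial.aeval y (lift3 vExp Q) / (y 2 ^ (m₀ + m₁ + m₂) * (y 0 ^ m₁ * (1 - y 0 * y 1) ^ m₂ * D (vΨ y)))
    rw [aeval_eq_sum_three Q (vΨ y), aeval_lift3, ← mul_div_assoc, vΨ_zero, vΨ_one, vΨ_two,
      show y 2 - y 2 * y 0 * y 1 = y 2 * (1 - y 0 * y 1) by ring, mul_pow, mul_pow,
      show y 2 ^ m₀ * (y 2 ^ m₁ * y 0 ^ m₁) * (y 2 ^ m₂ * (1 - y 0 * y 1) ^ m₂) * D (vΨ y) =
        y 2 ^ (m₀ + m₁ + m₂) * (y 0 ^ m₁ * (1 - y 0 * y 1) ^ m₂ * D (vΨ y)) by ring]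
    congr 1
    rw [Finset.mul_sum]
    refine Finset.sum_congr rfl fun e _ => ?_
    obtain ⟨a0, a1, a2⟩ := vExp_apply e
    rw [a0, a1, a2]
    ring
  have hDc' : ∀ x ∈ Sq, ContinuousAt
      (fun s : ℝ => (fun y : Fin 3 → ℝ => y 0 ^ m₁ * (1 - y 0 * y 1) ^ m₂ * D (vΨ y)) (Fin.snoc x s)) 0 := by
    intro x hx
    show ContinuousAt (fun s : ℝ => x 0 ^ m₁ * (1 - x 0 * x 1) ^ m₂ * D (vΨ (Fin.snoc x s))) 0
    exact continuousAt_const.mul (hDc x hx)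
  have hD0' : ∀ x ∈ Sq, (fun y : Fin 3 → ℝ => y 0 ^ m₁ * (1 - y 0 * y 1) ^ m₂ * D (vΨ y)) (Fin.snoc x (0:ℝ)) ≠ 0 := by
    intro x hx
    show x 0 ^ m₁ * (1 - x 0 * x 1) ^ m₂ * D (vΨ (Fin.snoc x (0:ℝ))) ≠ 0
    obtain ⟨hx0, hx01, hx1, hx11⟩ := hx
    have : 0 < 1 - x 0 * x 1 := by nlinarith
    exact mul_ne_zero (by positivity) (hD0 x ⟨hx0, hx01, hx1, hx11⟩)
  intro e he
  have key := cube_face _ hDc' hD0' (m₀ + m₁ + m₂) (lift3 vExp Q) h2 _ (mem_support_lift3 vExp_injective Q he)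
  rwa [(vExp_apply e).2.2] at key

/-- **EDGE ORDER.**  If `Q(t)/(t₁^{m} · D(t))` is integrable on `Δ₃`, `D ≠ 0` on `Δ₃` and, in the edge chart, continuous and non-zero at
the face `s = 0` along every section, then every monomial `e` of `Q` has `e₁ + e₂ ≥ m - 1` (order along the edge `t₁ = t₂ = 0`). -/
theorem edge_order (Q : MvPolynomial (Fin 3) ℚ) (m : ℕ) (D : (Fin 3 → ℝ) → ℝ)
    (hDnz : ∀ t ∈ KZ.openOrderedSimplex 3, D t ≠ 0)
    (hDc : ∀ x ∈ Sq, ContinuousAt (fun s : ℝ => D (eΨ (Fin.snoc x s))) 0)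
    (hD0 : ∀ x ∈ Sq, D (eΨ (Fin.snoc x (0:ℝ))) ≠ 0)
    (hint : IntegrableOn (fun t => MvPolynomial.aeval t Q / (t 1 ^ m * D t)) (KZ.openOrderedSimplex 3)) :
    ∀ e ∈ Q.support, m ≤ e 1 + e 2 + 1 := by
  have h1 := integrableOn_echart hint
  have h2 : IntegrableOn (fun y => MvPolynomial.aeval y (lift3 eExp Q) /
      (y 2 ^ m * (fun y : Fin 3 → ℝ => y 0 ^ m * D (eΨ y)) y)) Cube3 := by
    refine h1.congr_fun (fun y hy => ?_) measurableSet_Cube3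
    have hD : D (eΨ y) ≠ 0 := hDnz _ (eΨ_mem hy)
    obtain ⟨hy0, hy01, hy1, hy11, hy2, hy21⟩ := hy
    show y 0 ^ 2 * y 2 * (MvPolynomial.aeval (eΨ y) Q / (eΨ y 1 ^ m * D (eΨ y))) =
      MvPolynomial.aeval y (lift3 eExp Q) / (y 2 ^ m * (y 0 ^ m * D (eΨ y)))
    rw [aeval_eq_sum_three Q (eΨ y), aeval_lift3, ← mul_div_assoc, eΨ_zero, eΨ_one, eΨ_two, mul_pow,
      show y 0 ^ m * y 2 ^ m * D (eΨ y) = y 2 ^ m * (y 0 ^ m * D (eΨ y)) by ring]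
    congr 1
    rw [Finset.mul_sum]
    refine Finset.sum_congr rfl fun e _ => ?_
    obtain ⟨a0, a1, a2⟩ := eExp_apply e
    rw [a0, a1, a2]
    ring
  have hDc' : ∀ x ∈ Sq, ContinuousAt (fun s : ℝ => (fun y : Fin 3 → ℝ => y 0 ^ m * D (eΨ y)) (Fin.snoc x s)) 0 := by
    intro x hx
    show ContinuousAt (fun s : ℝ => x 0 ^ m * D (eΨ (Fin.snoc x s))) 0
    exact continuousAt_const.mul (hDc x hx)
  have hD0' : ∀ x ∈ Sq, (fun y : Fin 3 → ℝ => y 0 ^ m * D (eΨ y)) (Fin.snoc x (0:ℝ)) ≠ 0 := by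
    intro x hx
    show x 0 ^ m * D (eΨ (Fin.snoc x (0:ℝ))) ≠ 0
    have hx0 := hx.1
    exact mul_ne_zero (by positivity) (hD0 x hx)
  intro e he
  have key := cube_face _ hDc' hD0' m (lift3 eExp Q) h2 _ (mem_support_lift3 eExp_injective Q he)
  rwa [(eExp_apply e).2.2] at key

/-! ### 23d  The five orders of a reduced datum -/

/-- the reduced integrand of dimension 3: `P/(t₀^{β₀} t₁^{β₁} (1-t₁)^{γ₁} (1-t₂)^{γ₂} (t₀-t₂)^{α})` -/
def rf3 (p : MvPolynomial (Fin 3) ℚ) (β₀ β₁ γ₁ γ₂ α : ℕ) (t : Fin 3 → ℝ) : ℝ :=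
  MvPolynomial.aeval t p / (t 0 ^ β₀ * t 1 ^ β₁ * (1 - t 1) ^ γ₁ * (1 - t 2) ^ γ₂ * (t 0 - t 2) ^ α)

/-- vertex `(0,0,0)` and edge `t₁ = t₂ = 0` -/
theorem rf3_orders_origin (p : MvPolynomial (Fin 3) ℚ) (β₀ β₁ γ₁ γ₂ α : ℕ)
    (hint : IntegrableOn (rf3 p β₀ β₁ γ₁ γ₂ α) (KZ.openOrderedSimplex 3)) :
    (∀ e ∈ p.support, β₀ + β₁ + α ≤ e 0 + e 1 + e 2 + 2) ∧ (∀ e ∈ p.support, β₁ ≤ e 1 + e 2 + 1) := by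
  constructor
  · refine vertex_order p β₀ β₁ α (fun t => (1 - t 1) ^ γ₁ * (1 - t 2) ^ γ₂) (fun t ht => ?_) (fun x _ => ?_)
      (fun x _ => ?_) (hint.congr_fun (fun t ht => ?_) (measurableSet_simplex 3))
    · obtain ⟨h0, h1, h2, h3, h4, h5, h6, h7, h8⟩ := gz3_denoms_pos ht
      positivity
    · show ContinuousAt (fun s : ℝ => (1 - s * x 0) ^ γ₁ * (1 - s * x 0 * x 1) ^ γ₂) 0
      exact (by fun_prop : Continuous fun s : ℝ => (1 - s * x 0) ^ γ₁ * (1 - s * x 0 * x 1) ^ γ₂).continuousAt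
    · show ((1:ℝ) - 0 * x 0) ^ γ₁ * (1 - 0 * x 0 * x 1) ^ γ₂ ≠ 0
      simp
    · show rf3 p β₀ β₁ γ₁ γ₂ α t =
        MvPolynomial.aeval t p / (t 0 ^ β₀ * t 1 ^ β₁ * (t 0 - t 2) ^ α * ((1 - t 1) ^ γ₁ * (1 - t 2) ^ γ₂))
      rw [rf3]
      congr 1
      ring
  · refine edge_order p β₁ (fun t => t 0 ^ β₀ * (1 - t 1) ^ γ₁ * (1 - t 2) ^ γ₂ * (t 0 - t 2) ^ α) (fun t ht => ?_)
      (fun x _ => ?_) (fun x hx => ?_) (hint.congr_fun (fun t ht => ?_) (measurableSet_simplex 3))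
    · obtain ⟨h0, h1, h2, h3, h4, h5, h6, h7, h8⟩ := gz3_denoms_pos ht
      positivity
    · show ContinuousAt (fun s : ℝ => x 0 ^ β₀ * (1 - x 0 * s) ^ γ₁ * (1 - x 0 * s * x 1) ^ γ₂ * (x 0 - x 0 * s * x 1) ^ α) 0
      exact (by fun_prop : Continuous fun s : ℝ => x 0 ^ β₀ * (1 - x 0 * s) ^ γ₁ * (1 - x 0 * s * x 1) ^ γ₂ *
        (x 0 - x 0 * s * x 1) ^ α).continuousAt
    · show x 0 ^ β₀ * (1 - x 0 * 0) ^ γ₁ * (1 - x 0 * 0 * x 1) ^ γ₂ * (x 0 - x 0 * 0 * x 1) ^ α ≠ 0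
      have hx0 := hx.1
      simp only [mul_zero, zero_mul, sub_zero]
      positivity
    · show rf3 p β₀ β₁ γ₁ γ₂ α t =
        MvPolynomial.aeval t p / (t 1 ^ β₁ * (t 0 ^ β₀ * (1 - t 1) ^ γ₁ * (1 - t 2) ^ γ₂ * (t 0 - t 2) ^ α))
      rw [rf3]
      congr 1
      ring

/-- reduced data are self-dual: `σ₃` carries `rf3 p β₀ β₁ γ₁ γ₂ α` to `rf3 p^σ γ₂ γ₁ β₁ β₀ α` -/
theorem rf3_dual (p : MvPolynomial (Fin 3) ℚ) (β₀ β₁ γ₁ γ₂ α : ℕ)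
    (hint : IntegrableOn (rf3 p β₀ β₁ γ₁ γ₂ α) (KZ.openOrderedSimplex 3)) :
    IntegrableOn (rf3 (duP3 p) γ₂ γ₁ β₁ β₀ α) (KZ.openOrderedSimplex 3) := by
  refine (integrableOn_comp_duΦ hint).congr_fun (fun u _ => ?_) (measurableSet_simplex 3)
  show rf3 p β₀ β₁ γ₁ γ₂ α (duΦ u) = rf3 (duP3 p) γ₂ γ₁ β₁ β₀ α u
  rw [rf3, rf3, aeval_duP3, duΦ_zero, duΦ_one, duΦ_two, sub_sub_cancel, sub_sub_cancel,
    show (1:ℝ) - u 2 - (1 - u 0) = u 0 - u 2 by ring]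
  congr 1
  ring

/-- vertex `(1,1,1)` and edge `t₀ = t₁ = 1`, read on the dual datum -/
theorem rf3_orders_far (p : MvPolynomial (Fin 3) ℚ) (β₀ β₁ γ₁ γ₂ α : ℕ)
    (hint : IntegrableOn (rf3 p β₀ β₁ γ₁ γ₂ α) (KZ.openOrderedSimplex 3)) :
    (∀ e ∈ (duP3 p).support, γ₂ + γ₁ + α ≤ e 0 + e 1 + e 2 + 2) ∧ (∀ e ∈ (duP3 p).support, γ₁ ≤ e 1 + e 2 + 1) :=
  rf3_orders_origin (duP3 p) γ₂ γ₁ β₁ β₀ α (rf3_dual p β₀ β₁ γ₁ γ₂ α hint)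

/-- the diagonal edge `t₀ = t₁ = t₂`, carried onto `t₁ = t₂ = 0` by `τ₀₁` -/
theorem rf3_order_diag (p : MvPolynomial (Fin 3) ℚ) (β₀ β₁ γ₁ γ₂ α : ℕ)
    (hint : IntegrableOn (rf3 p β₀ β₁ γ₁ γ₂ α) (KZ.openOrderedSimplex 3)) :
    ∀ e ∈ (s01P p).support, α ≤ e 1 + e 2 + 1 := by
  refine edge_order (s01P p) α (fun u => u 0 ^ β₀ * (u 0 - u 2) ^ β₁ * (1 - u 0 + u 2) ^ γ₁ * (1 - u 0 + u 1) ^ γ₂)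
    (fun u hu => ?_) (fun x _ => ?_) (fun x hx => ?_)
    ((integrableOn_comp_s01 hint).congr_fun (fun u hu => ?_) (measurableSet_simplex 3))
  · obtain ⟨h0, h1, h2, h3, h4, h5, h6, h7, h8⟩ := gz3_denoms_pos hu
    have : 0 < 1 - u 0 + u 2 := by linarith
    have : 0 < 1 - u 0 + u 1 := by linarith
    positivity
  · show ContinuousAt (fun s : ℝ => x 0 ^ β₀ * (x 0 - x 0 * s * x 1) ^ β₁ * (1 - x 0 + x 0 * s * x 1) ^ γ₁ *
      (1 - x 0 + x 0 * s) ^ γ₂) 0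
    exact (by fun_prop : Continuous fun s : ℝ => x 0 ^ β₀ * (x 0 - x 0 * s * x 1) ^ β₁ * (1 - x 0 + x 0 * s * x 1) ^ γ₁ *
      (1 - x 0 + x 0 * s) ^ γ₂).continuousAt
  · show x 0 ^ β₀ * (x 0 - x 0 * 0 * x 1) ^ β₁ * (1 - x 0 + x 0 * 0 * x 1) ^ γ₁ * (1 - x 0 + x 0 * 0) ^ γ₂ ≠ 0
    obtain ⟨hx0, hx01, hx1, hx11⟩ := hx
    have : 0 < 1 - x 0 := by linarith
    simp only [mul_zero, zero_mul, sub_zero, add_zero]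
    positivity
  · obtain ⟨h0, h1, h2, h3, h4, h5, h6, h7, h8⟩ := gz3_denoms_pos hu
    have h9 : 0 < 1 - u 0 + u 2 := by linarith
    have h10 : 0 < 1 - u 0 + u 1 := by linarith
    show rf3 p β₀ β₁ γ₁ γ₂ α (s01 u) = MvPolynomial.aeval u (s01P p) /
      (u 1 ^ α * (u 0 ^ β₀ * (u 0 - u 2) ^ β₁ * (1 - u 0 + u 2) ^ γ₁ * (1 - u 0 + u 1) ^ γ₂))
    rw [rf3, aeval_s01P, s01_zero, s01_one, s01_two, sub_sub_cancel,
      show (1:ℝ) - (u 0 - u 2) = 1 - u 0 + u 2 by ring, show (1:ℝ) - (u 0 - u 1) = 1 - u 0 + u 1 by ring]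
    congr 1
    ring

/-- **THE FIVE ORDERS OF A REDUCED DATUM FORCED BY INTEGRABILITY** (two vertices, three edges; the four faces are §22). -/
theorem reduced_orders (p : MvPolynomial (Fin 3) ℚ) (β₀ β₁ γ₁ γ₂ α : ℕ)
    (hint : IntegrableOn (rf3 p β₀ β₁ γ₁ γ₂ α) (KZ.openOrderedSimplex 3)) :
    (∀ e ∈ p.support, β₀ + β₁ + α ≤ e 0 + e 1 + e 2 + 2) ∧ (∀ e ∈ p.support, β₁ ≤ e 1 + e 2 + 1) ∧
    (∀ e ∈ (duP3 p).support, γ₂ + γ₁ + α ≤ e 0 + e 1 + e 2 + 2) ∧ (∀ e ∈ (duP3 p).support, γ₁ ≤ e 1 + e 2 + 1) ∧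
    (∀ e ∈ (s01P p).support, α ≤ e 1 + e 2 + 1) := by
  obtain ⟨h1, h2⟩ := rf3_orders_origin p β₀ β₁ γ₁ γ₂ α hint
  obtain ⟨h3, h4⟩ := rf3_orders_far p β₀ β₁ γ₁ γ₂ α hint
  exact ⟨h1, h2, h3, h4, rf3_order_diag p β₀ β₁ γ₁ γ₂ α hint⟩

/-- **ORDERS OF A REDUCED REPRESENTATION** (the content of the proposed stub `gz_ladder.stub_three_orders`): the item-level form. -/
theorem reducedOrders_of_isReduced_three (r : KZ.IntegralRep 3) (hd : r.domain = KZ.openOrderedSimplex 3)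
    (p : MvPolynomial (Fin 3) ℚ) (β₀ β₁ γ₁ γ₂ α : ℕ)
    (hi : EqOn r.integrand (fun t => MvPolynomial.aeval t p /
      (t 0 ^ β₀ * t 1 ^ β₁ * (1 - t 1) ^ γ₁ * (1 - t 2) ^ γ₂ * (t 0 - t 2) ^ α)) r.domain) :
    (∀ e ∈ p.support, β₀ + β₁ + α ≤ e 0 + e 1 + e 2 + 2) ∧ (∀ e ∈ p.support, β₁ ≤ e 1 + e 2 + 1) ∧
    (∀ e ∈ (duP3 p).support, γ₂ + γ₁ + α ≤ e 0 + e 1 + e 2 + 2) ∧ (∀ e ∈ (duP3 p).support, γ₁ ≤ e 1 + e 2 + 1) ∧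
    (∀ e ∈ (s01P p).support, α ≤ e 1 + e 2 + 1) :=
  reduced_orders p β₀ β₁ γ₁ γ₂ α
    ((hd ▸ r.integrableOn).congr_fun (fun t ht => hi (by rw [hd]; exact ht)) (measurableSet_simplex 3))

end OrdersThree

end Summit.KontsevichZagierPeriods.KontsevichZagierPeriods.Theorems.RootDecompZetaThreeFrontierWordMoves

/-! ## §23e  `gz_ladder.stub_three_orders` (REGISTERED stub of skeleton v3 @1c2778ca) BY NAME AND SIGNATURE (gen 11)

The registered skeleton `gz_ladder` on item 32433 (writer g5, `a5/gz_ladder32433.lean` @095cff74, namespace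
`…Cruxes.GZNormalFormWThree.GZLadder`) states `stub_three_wlog : ∀ r : KZ.IntegralRep 3, IsGZ 3 r → IsReducedThree r` over the
skeleton-local defs `simplex`, `IsGZ`, `IsReducedThree` (reproduced VERBATIM below).  It is `isReduced_of_isGZ_three` unfolded
(`simplex 3` is literally `KZ.openOrderedSimplex 3`). -/

set_option linter.dupNamespace false

namespace Summit.KontsevichZagierPeriods.KontsevichZagierPeriods.Cruxes.GZNormalFormWThree.GZLadder

open Set MeasureTheory Literature.NumberTheory.Transcendental

-- `simplex`, `IsGZ`, `IsReducedThree`, `stub_three_wlog` are in the tree (`…Theorems.RootDecompZetaThreeFrontierGZLadderThreeWlog`, p775955).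

/-! ### (gen 11, §23) proposed typed split of `stub_three_reduce`: ORDERS (proved) ∧ MATCH (residual)

`IsReducedOrdThree r` = `IsReducedThree r` + the five vertex/edge ORDER CONDITIONS that integrability forces (§23); with all
orders `0` they are exactly `IsLayerThree`.  `stub_three_orders` is PROVED (`WordLayer.reducedOrders_of_isReduced_three`);
`stub_three_match : ∀ r, IsReducedOrdThree r → CongInto (layerThree ∪ gzLETwo) (KZ.of r)` is the move-calculus residual
(Taylor matching at two vertices and three edges); `stub_three_reduce` follows from the two by composition (writer's file). -/

/-- `P ↦ P(1-t₂, 1-t₁, 1-t₀)` (the duality `σ₃` on polynomials; = `WordLayer.duP3`) -/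
noncomputable def dual3 (p : MvPolynomial (Fin 3) ℚ) : MvPolynomial (Fin 3) ℚ :=
  MvPolynomial.bind₁ ![MvPolynomial.C 1 - MvPolynomial.X 2, MvPolynomial.C 1 - MvPolynomial.X 1,
    MvPolynomial.C 1 - MvPolynomial.X 0] p

/-- `P ↦ P(t₀, t₀-t₂, t₀-t₁)` (the involution `τ₀₁` on polynomials; = `WordLayer.s01P`) -/
noncomputable def diag3 (p : MvPolynomial (Fin 3) ℚ) : MvPolynomial (Fin 3) ℚ :=
  MvPolynomial.bind₁ ![MvPolynomial.X 0, MvPolynomial.X 0 - MvPolynomial.X 2, MvPolynomial.X 0 - MvPolynomial.X 1] p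

/-- REDUCED dimension-3 data WITH THE ORDERS integrability forces: vertex `(0,0,0)`: `β₀+β₁+α ≤ |e|+2`; edge `t₁=t₂=0`:
`β₁ ≤ e₁+e₂+1` (`e ∈ supp P`); vertex `(1,1,1)`: `γ₂+γ₁+α ≤ |e|+2`; edge `t₀=t₁=1`: `γ₁ ≤ e₁+e₂+1` (`e ∈ supp P^σ`); diagonal
edge `t₀=t₁=t₂`: `α ≤ e₁+e₂+1` (`e ∈ supp P^τ`). -/
def IsReducedOrdThree (r : KZ.IntegralRep 3) : Prop :=
  r.domain = simplex 3 ∧ ∃ (p : MvPolynomial (Fin 3) ℚ) (β₀ β₁ γ₁ γ₂ α : ℕ),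
    (∀ e ∈ p.support, β₀ + β₁ + α ≤ e 0 + e 1 + e 2 + 2) ∧ (∀ e ∈ p.support, β₁ ≤ e 1 + e 2 + 1) ∧
    (∀ e ∈ (dual3 p).support, γ₂ + γ₁ + α ≤ e 0 + e 1 + e 2 + 2) ∧ (∀ e ∈ (dual3 p).support, γ₁ ≤ e 1 + e 2 + 1) ∧
    (∀ e ∈ (diag3 p).support, α ≤ e 1 + e 2 + 1) ∧
    EqOn r.integrand (fun t => MvPolynomial.aeval t p /
      (t 0 ^ β₀ * t 1 ^ β₁ * (1 - t 1) ^ γ₁ * (1 - t 2) ^ γ₂ * (t 0 - t 2) ^ α)) r.domain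

end Summit.KontsevichZagierPeriods.KontsevichZagierPeriods.Cruxes.GZNormalFormWThree.GZLadder
end
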